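import Summits.BirchSwinnertonDyer.BirchSwinnertonDyer.Theorems.KatoDescentPotSupersingularWildUpperMuRoadThreeFukudaRecordsQuad29
import Summits.BirchSwinnertonDyer.BirchSwinnertonDyer.Theorems.KatoDescentPotSupersingularWildUpperMuRoadThreeUnipotentRecordsNoF04
import HarnessLib

/-!
# Route `KatoDescentPotSupersingular` (rung K9, sub-rung B5 = O6 wild `p = 3`, cell `bsd-potss`): the three MISSING fact-free (A)@3 TWINS of the
# K9 U₀-ns table — rows 292032ej1, 292032en1 (`3Ns`, the imaginary-quadratic / `K⁺` rank road of k8t-c4 g23) and 388800ij1 (`GL₂(𝔽₃)` 9-deficient,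
# the unipotent-stabilizer-field road with `hLim` / `hF1` DISCHARGED) — seat `bsd-potss-k9-c4` g27 (`--supports stmt-BirchSwinnertonDyer-19197 --as helper`)

HONEST FRAMING. THEOREMS ONLY (no definition, no named fact, no `sorry`); PER ROW — NOT a class theorem; nothing is booked; items 19189 / 19197 /
19386 / 19942 stay OPEN at class level (class-wide open inputs unchanged: the zeta crux 24327, the residual 19200, the cite-only 19191);
statement (A) of Coates–Sujatha, Conjecture A and BSD are proved for NO curve as a class.  Each theorem is CONDITIONAL on the displayed NUMERIC
hypotheses of its row — EXACTLY the hypotheses already displayed by the row's U₀ record in the tree (`missingUpperBoundAt_g292032ej1_3_fkK12rQuad`,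
`missingUpperBoundAt_g292032en1_3_fkK12rQuad` in `…WildUpperMuRoadThreeFukudaRecordsQuad29`, k8t-c4 g23 courtesy; `missingUpperBoundAt_g388800ij1_3_lp12NoF`
in `…WildUpperMuRoadThreeUnipotentRecordsNoF04`, k9-c4 g25) — and on NO named fact: this file only factors the statement-(A) half out of those
U₀ records, so that the K9 U₀-ns table's (A)@3 census reads 364/364 fact-free (k9-c4 g26final census: 361/364; the three rows here were the gap)
and the registered stub `stub_fineA_wild_surjModThree` of 19386 (the 20 `GL₂(𝔽₃)` rows) reads 20/20 fact-free (conjA-anchor g23 pointer, 2026-08-29T18:51Z (1):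
`conjA_g388800ij1_3_lp12` in `…WildFineAUnitIndexRow388800ij1` still displays `hLim` / `hF1`, both TREE THEOREMS since rkm g34 / k8t-c4 g20:
`Lim2017.thm35_fineSelmerDual_moduleFinite_of_classicalMuVanishes_of_le_divisionField_holds`, `fukuda1994_thm1_classNumberPExp_const_of_succ_eq_holds`).

ROADS (all KERNEL theorems; `p = 3`):
* 292032ej1 / 292032en1 (`Gal(ℚ(E[3])/ℚ) = N_s(3) ≅ D₄`, quadratic subfields `ℚ(√−39)`, `ℚ(√−3)`, `ℚ(√13)` — kit j327492): door
  `CartanMuRoadQuadraticDoors.conjA_three_of_hasSplitCartanNormalizerModPImage_of_realRankSuccEqAt_of_quadRankSuccEqAt` (k8t-c4 g23,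
  `…KatoDescentTamePotSupersingularCartanMuRoadQuadraticDoors`): `E[3]` irreducible + split-Cartan-normaliser image (kernel certificates
  `irr_g…_3`, `hasSplitCartanNormalizerModPImage_g…_3`, IMPORTED) + a complex conjugation `c` + DISPLAYED `hrk` («`rank₃ Cl(K⁺₂) = rank₃ Cl(K⁺₁)` on
  every cyclotomic `ℤ₃`-tower of `K⁺ = ℚ(E[3])^c`», the `K⁺` datum of the source record `…FukudaRecords29`, kit j314795 / j327492) + DISPLAYED `hqrk`
  («`rank₃ Cl(K₁) = rank₃ Cl(K₀)` for every quadratic `K ⊆ ℚ(E[3])` not fixed by `c`», i.e. for `ℚ(√−3)` (`h = 1`, `h(K₁) = 1`) and `ℚ(√−39)`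
  (`h = 4`, `h(K₁) = 4`), bnfcertify 1/1, kit j327492) ⟹ classical `μ₃ = 0` for the needed subfields by Fukuda Thm. 1 (2) (index `0` by Serre
  Prop. 15) ⟹ (A) at `(E, 3)` by Coates–Sujatha Thm. 3.4 along the `D₄` character count — NO Ferrero–Washington, NO named fact.
* 388800ij1 (`ρ̄_{E,3}` onto, 9-deficient tower; `L_P = ℚ(E[3])^{U_P} = ℚ(P, ζ₃)` degree 16): door
  `Lim2017.fineSelmerDual_moduleFinite_of_classNumberPExp_succ_eq_unipotentStabilizerField` with its two named-fact binders SUPPLIED by the tree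
  theorems `fukuda1994_thm1_classNumberPExp_const_of_succ_eq_holds` and `Lim2017.thm35_…_holds`; DISPLAYED `hram` (Fukuda index `0` on `L_P`, exact,
  kit j296187 / j308542) and `hord` (`e₂(L_P) = e₁(L_P)`; evidence: door UG at layers `(1,2)` on `O_grow = ℚ(P)`, kit j316285 / j311095, GRH through
  `h(O_grow·ℚ(ζ₉)⁺) = 6`, + Kuroda + the PASS:UNIT leaves — module docstrings of `…UnipotentRecordsNoF04` / `…WildFineAUnitIndexRow388800ij1`).
KERNEL lemmas `irr_g…_3`, `hasSplitCartanNormalizerModPImage_g…_3`, `isElliptic_g…` are IMPORTED (k9-c4 g16–g25 / k8t-c4 files, namespaces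
`…Theorems.WildUpperUnitTwistRecords` / `…Theorems.TameUpperUnitTwistRecords`); nothing is re-declared.  The identification of the Lean fields with the
PARI polynomials is the census memos' (evidence on 19197 / 19386), not a kernel statement.

References: [CoatesSujatha2005] Thm. 3.4 (§3), Lemma 3.8; [Fukuda1994] Thm. 1 (1), (2), p. 264; [Lim2017FineSelmer] §3 Thm. 3.5, Lemma 3.2;
[Serre1972] §2.2, §2.4 Prop. 15, §5.2 (iv); [Washington1997] §13.1, §13.3 Prop. 13.22–13.23; [Cremona2006] Table 1.
-/

set_option autoImplicit false
set_option linter.dupNamespace false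

noncomputable section

open scoped Classical NumberField
open Polynomial WeierstrassCurve NumberField Field IntermediateField IsDedekindDomain
  Literature.NumberTheory.EllipticCurves Literature.NumberTheory.EllipticCurves.Rank1Residual
  Literature.NumberTheory.EllipticCurves.Rank1Residual.Typed
  Literature.NumberTheory.GaloisRepresentations Literature.NumberTheory.SerreUniformity Literature.NumberTheory.IwasawaTheory
  Summit.BirchSwinnertonDyer.Rank1Residual Summit.BirchSwinnertonDyer.Rank1Residual.Additive
  Summit.BirchSwinnertonDyer.BirchSwinnertonDyer.Theorems
  Summit.BirchSwinnertonDyer.BirchSwinnertonDyer.Theorems.TameUpperUnitTwistRecords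

namespace Summit.BirchSwinnertonDyer.BirchSwinnertonDyer.Theorems.WildUpperUnitTwistRecords

/-! ## §1 `3Ns` rows 292032ej1 / 292032en1 — (A) twin of k8t-c4 g23's FW-free U₀ records `_fkK12rQuad` (same displayed data, NO named fact) -/

/-- **(A) AT `(292032ej1, 3)`, NO named fact** — twin of `missingUpperBoundAt_g292032ej1_3_fkK12rQuad`: `E[3]` irreducible with split-Cartan-normaliser
image (kernel), a complex conjugation `c`, DISPLAYED `hrk` (`rank₃ Cl(K⁺₂) = rank₃ Cl(K⁺₁)` on `K⁺ = ℚ(E[3])^c`, kit j314795 / j327492) and `hqrk` (quadratic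
subfields of `ℚ(E[3])` = `ℚ(√−39)`, `ℚ(√−3)`, `ℚ(√13)`, kit j327492 (`ψ₃ = q₁·q₂`); the imaginary ones: `ℚ(√−3)`: `h = 1`, `K₁ = x^6 − x^3 + 1`, `h(K₁) = 1`;
`ℚ(√−39)`: `h = 4` (`Cl ≅ [4]`), `K₁ = x^6 + 18x^4 − 10x^3 + 81x^2 − 90x + 181`, `h(K₁) = 4` (`Cl ≅ [4]`); `rank₃` at layers `(0,1)`: `0 = 0`, bnfcertify 1/1).
Then statement (A) holds for `E` at `3` over every cyclotomic `ℤ₃`-extension of `ℚ`. Per row; CONDITIONAL on the displayed data; nothing booked; (A)/BSD proved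
for no curve. [cite: Fukuda1994, Thm. 1 (2), p. 264] [cite: CoatesSujatha2005, Thm. 3.4 (§3)] [cite: Serre1972, §2.2, §2.4 Prop. 15, §5.2 (iv)]
[cite: Cremona2006, Table 1 (Cremona label 292032ej1)] -/
theorem conjA_g292032ej1_3_fkK12rQuad
    {W : WeierstrassCurve ℚ} [W.IsElliptic] (hWeq : W = (⟨0, 0, 0, (-131820), 41584816⟩ : WeierstrassCurve ℚ))
    {c : absoluteGaloisGroup ℚ} (hc : IsComplexConjugation (Rat.castHom ℝ) c)
    (hrk : haveI : NumberField ↥(W.divisionField 3) := NumberField.mk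
      ∀ κE : ZpExtension ↥(fixedField (Subgroup.zpowers (absRestrictNormalHom (W.divisionField 3) c))) 3,
        κE.IsCyclotomic → classGroupPRank κE (1 + 1) = classGroupPRank κE 1)
    (hqrk : haveI : NumberField ↥(W.divisionField 3) := NumberField.mk
      ∀ K : IntermediateField ℚ ↥(W.divisionField 3), Module.finrank ℚ ↥K = 2 →
        ¬ K ≤ fixedField (Subgroup.zpowers (absRestrictNormalHom (W.divisionField 3) c)) →
        ∀ κE : ZpExtension ↥K 3, κE.IsCyclotomic → classGroupPRank κE (0 + 1) = classGroupPRank κE 0)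
    (κ : ZpExtension ℚ 3) (hκ : κ.IsCyclotomic) :
    ∃ (γ : absoluteGaloisGroup ℚ) (Df : W.FineSelmerDualData κ γ),
      Module.Finite ℤ_[3] (RestrictScalars ℤ_[3] (IwasawaAlgebra 3) Df.X) := by
  subst hWeq
  haveI : Fact (Nat.Prime 3) := ⟨Nat.prime_three⟩
  exact CartanMuRoadQuadraticDoors.conjA_three_of_hasSplitCartanNormalizerModPImage_of_realRankSuccEqAt_of_quadRankSuccEqAt _
    irr_g292032ej1_3 hasSplitCartanNormalizerModPImage_g292032ej1_3 hc 1 hrk 0 hqrk κ hκ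

/-- **(A) AT `(292032en1, 3)`, NO named fact** — twin of `missingUpperBoundAt_g292032en1_3_fkK12rQuad`: `E[3]` irreducible with split-Cartan-normaliser
image (kernel), a complex conjugation `c`, DISPLAYED `hrk` (`rank₃ Cl(K⁺₂) = rank₃ Cl(K⁺₁)` on `K⁺ = ℚ(E[3])^c`, kit j314795 / j327492) and `hqrk` (quadratic
subfields of `ℚ(E[3])` = `ℚ(√−39)`, `ℚ(√−3)`, `ℚ(√13)`, kit j327492; the imaginary ones: `ℚ(√−3)`: `h = 1`, `h(K₁) = 1`; `ℚ(√−39)`: `h = 4`, `h(K₁) = 4`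
(`K₁ = x^6 + 18x^4 − 10x^3 + 81x^2 − 90x + 181`); `rank₃` at layers `(0,1)`: `0 = 0`, bnfcertify 1/1). Then statement (A) holds for `E` at `3` over every cyclotomic
`ℤ₃`-extension of `ℚ`. Per row; CONDITIONAL on the displayed data; nothing booked; (A)/BSD proved for no curve. [cite: Fukuda1994, Thm. 1 (2), p. 264]
[cite: CoatesSujatha2005, Thm. 3.4 (§3)] [cite: Serre1972, §2.2, §2.4 Prop. 15, §5.2 (iv)] [cite: Cremona2006, Table 1 (Cremona label 292032en1)] -/
theorem conjA_g292032en1_3_fkK12rQuad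
    {W : WeierstrassCurve ℚ} [W.IsElliptic] (hWeq : W = (⟨0, 0, 0, (-780), 18928⟩ : WeierstrassCurve ℚ))
    {c : absoluteGaloisGroup ℚ} (hc : IsComplexConjugation (Rat.castHom ℝ) c)
    (hrk : haveI : NumberField ↥(W.divisionField 3) := NumberField.mk
      ∀ κE : ZpExtension ↥(fixedField (Subgroup.zpowers (absRestrictNormalHom (W.divisionField 3) c))) 3,
        κE.IsCyclotomic → classGroupPRank κE (1 + 1) = classGroupPRank κE 1)
    (hqrk : haveI : NumberField ↥(W.divisionField 3) := NumberField.mk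
      ∀ K : IntermediateField ℚ ↥(W.divisionField 3), Module.finrank ℚ ↥K = 2 →
        ¬ K ≤ fixedField (Subgroup.zpowers (absRestrictNormalHom (W.divisionField 3) c)) →
        ∀ κE : ZpExtension ↥K 3, κE.IsCyclotomic → classGroupPRank κE (0 + 1) = classGroupPRank κE 0)
    (κ : ZpExtension ℚ 3) (hκ : κ.IsCyclotomic) :
    ∃ (γ : absoluteGaloisGroup ℚ) (Df : W.FineSelmerDualData κ γ),
      Module.Finite ℤ_[3] (RestrictScalars ℤ_[3] (IwasawaAlgebra 3) Df.X) := by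
  subst hWeq
  haveI : Fact (Nat.Prime 3) := ⟨Nat.prime_three⟩
  exact CartanMuRoadQuadraticDoors.conjA_three_of_hasSplitCartanNormalizerModPImage_of_realRankSuccEqAt_of_quadRankSuccEqAt _
    irr_g292032en1_3 hasSplitCartanNormalizerModPImage_g292032en1_3 hc 1 hrk 0 hqrk κ hκ

/-! ## §2 `GL₂(𝔽₃)` row 388800ij1 — NoF (A) twin of `conjA_g388800ij1_3_lp12` (`hLim` / `hF1` DISCHARGED by the tree `_holds` theorems) -/

/-- **[NoF re-issue of `conjA_g388800ij1_3_lp12` (k9-c4 g21, `…WildFineAUnitIndexRow388800ij1`): its named facts `hLim` (Lim 2017 Thm. 3.5) and `hF1` (Fukuda 1994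
Thm. 1 (1)) are DISCHARGED here by the tree theorems `Lim2017.thm35_fineSelmerDual_moduleFinite_of_classicalMuVanishes_of_le_divisionField_holds` /
`fukuda1994_thm1_classNumberPExp_const_of_succ_eq_holds` — NO named fact remains.]** **(A) AT `(388800ij1, 3)` with the `μ`-hypothesis DISCHARGED by FUKUDA
Thm. 1 (1) at layers `(1,2)` on `L_P = ℚ(E[3])^{U_P}`**: `P` any geometric `3`-torsion point; displayed numerics on `L_P` (degree 16, `= ℚ(P, ζ₃)`): Fukuda index `0`
(`hram`, exact: kit j296187 / j308542) and `e₂(L_P) = e₁(L_P)` (`hord`; evidence: door UG on `O_grow = ℚ(P)` at `(1,2)`, kit j316285 / j311095, GRH through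
`h(O_grow·ℚ(ζ₉)⁺) = 6` only, + Kuroda + Fukuda `(0,1)` on the non-growing leaves, kit j296187 — see the module docstrings of `…UnipotentRecordsNoF04` and
`…WildFineAUnitIndexRow388800ij1`). A row of 19386's stub `stub_fineA_wild_surjModThree` (with this theorem: 20/20 rows fact-free). CONDITIONAL on the displayed
data; nothing booked; (A)/BSD proved for no curve. [cite: Lim2017FineSelmer, §3 Thm. 3.5 and Lemma 3.2 (arXiv:1306.2047 pp. 6–7)] [cite: Fukuda1994, Thm. 1 (1), p. 264]
[cite: Cremona2006, Table 1 (Cremona label 388800ij1)] -/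
theorem conjA_g388800ij1_3_lp12NoF
    {W : WeierstrassCurve ℚ} [W.IsElliptic] (hWeq : W = (⟨0, 0, 0, (-121500), 16301250⟩ : WeierstrassCurve ℚ)) (P : W.geomTorsion (3 : ℕ))
    (hram : ∀ κ : ZpExtension ↥(W.unipotentStabilizerField 3 P) 3, κ.IsCyclotomic → TotallyRamifiedFrom κ 0)
    (hord : ∀ κ : ZpExtension ↥(W.unipotentStabilizerField 3 P) 3, κ.IsCyclotomic →
      classNumberPExp κ (1 + 1) = classNumberPExp κ 1)
    (κ : ZpExtension ℚ 3) (hκ : κ.IsCyclotomic) :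
    ∃ (γ : absoluteGaloisGroup ℚ) (Df : W.FineSelmerDualData κ γ),
      Module.Finite ℤ_[3] (RestrictScalars ℤ_[3] (IwasawaAlgebra 3) Df.X) := by
  subst hWeq
  haveI : Fact (Nat.Prime 3) := ⟨Nat.prime_three⟩
  exact Lim2017.fineSelmerDual_moduleFinite_of_classNumberPExp_succ_eq_unipotentStabilizerField
    fukuda1994_thm1_classNumberPExp_const_of_succ_eq_holds
    Lim2017.thm35_fineSelmerDual_moduleFinite_of_classicalMuVanishes_of_le_divisionField_holds _ 3 (by decide) 1 P hram hord κ hκ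

end Summit.BirchSwinnertonDyer.BirchSwinnertonDyer.Theorems.WildUpperUnitTwistRecords

end
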